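import Summits.MatrixMultiplication.OmegaCensus.DominoNormCongruence
import Summits.MatrixMultiplication.OmegaCensus.DominoLineCertificate
import Mathlib.NumberTheory.Divisors
import HarnessLib

/-!
# The norm congruence for domino cube law TPP triples; the `ℤ_p × ℤ_p` domino column for all `p`

ω-census `pub-omega`, family (b3), seat pub-omega-group gen 30.  Framing: lottery ticket; floor = certified bounds/negative
ranges.  VALUE: an all-`p`, all-`d` KERNEL theorem for the domino column of the Dih-side `|A| ≡ 1 (mod 3)` law classification —
it replaces the per-prime, per-`d` certificate tables (`DominoZpZp*`, `DominoZ{p}Z{p}*Cells`) and the ENGINE verdicts of the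
larger cells by one congruence; NOT progress on ω.

**Theorem (`card_dvd_of_domino_law_onto`).**  Dihedral-like `G` over a finite abelian `A` (`ρaρb = ρ(a+b)`, `ρaτb = τ(b−a)`,
`τaρb = τ(a+b)`, `τaτb = ρ(c₀+b−a)`, any `c₀`, any parity), a surjection `φ : A →+ B` onto a group of exponent `p`, `p ≥ 5`
prime, and a TPP triple of coset-part shape `(1,1 | d,d | e,e)` attaining the law `3|S||T||U| + 8 = 8|A|`.  Then
`|B| ∣ (3d²)^{p−1} − 1` and `|B| ∣ (3e²)^{p−1} − 1`
(`DominoShiftedForm.domino_shifted_form_of_law` + `radon_identity_shifted` + `DominoNorm.card_dvd_of_shifted_line_identity`).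

**Corollaries (`B = ℤ_p × ℤ_p`, `|A| = p²`, so `de = (p² − 1)/3`).**  A domino cube law triple over `A ↠ ℤ_p²` of order `p²`
needs a divisor `d` of `(p²−1)/3` with `(3d²)^{p−1} ≡ 1 (mod p²)`.  By `decide` over the divisors:
* `no_domino_law_onto_zpzp_sq` for `p = 5, 17, 19, 23, 29, 31`: **no domino cube law triple at all** (every `d`);
* `p = 7`: only `d = e = 4` survives (cell `(1,4,4)@49`, excluded in the kernel by `DominoZ7Z7Cells`); `p = 11`: only
  `{d, e} = {1, 40}` (two parts of size `1`: excluded for every `A` without an element of order `≥ |A|/2` by the two-singleton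
  law theorems); `p = 13`: only `{d, e} = {7, 8}` (cell `(1,7,8)@169`, kernel, census NR177).
Among all `11 664` pairs `(p, d)`, `5 ≤ p < 3000`, `d ≤ e`, exactly `20` survive the congruence (seat table
`HOME/pub-omega-group-g30/SURVIVORS.md`); in particular the ENGINE-only census cells `(1,8,35)`, `(1,10,28)`, `(1,14,20)@841`
and `(1,8,40)`, `(1,10,32)`, `(1,16,20)@961` (NR209/NR212) and every `d ≥ 6` cell at `p = 17, 19, 23` are now kernel NONE.
-/

namespace Summit.MatrixMultiplication.OmegaCensus

open Literature.Combinatorics.Additive Finset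

/-! ## The TPP statement over any exponent-`p` quotient -/

section DihedralLike

variable {A : Type*} [AddCommGroup A] [DecidableEq A] [Fintype A] {G : Type} [Group G] [DecidableEq G]
  {ρ τ : A → G} {c₀ : A} {S T U : Finset G}
  {B : Type*} [AddCommGroup B] [Fintype B] [DecidableEq B] {p : ℕ} [hp : Fact p.Prime]

/-- **Norm congruence for domino cube law triples**: over `A ↠ B`, `B` of exponent `p ≥ 5`, a law-attaining TPP triple of
coset-part shape `(1,1 | d,d | e,e)` forces `|B| ∣ (3d²)^{p−1} − 1` and `|B| ∣ (3e²)^{p−1} − 1`. [folklore] -/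
theorem card_dvd_of_domino_law_onto
    (hρρ : ∀ a b, ρ a * ρ b = ρ (a + b)) (hρτ : ∀ a b, ρ a * τ b = τ (b - a))
    (hτρ : ∀ a b, τ a * ρ b = τ (a + b)) (hττ : ∀ a b, τ a * τ b = ρ (c₀ + b - a))
    (hρ : Function.Injective ρ) (hτ : Function.Injective τ) (hne : ∀ a b, ρ a ≠ τ b)
    (hsurj : ∀ g, (∃ a, ρ a = g) ∨ (∃ a, τ a = g))
    (φ : A →+ B) (hφ : Function.Surjective φ) (hp5 : 5 ≤ p) (hexp : ∀ b : B, p • b = 0)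
    (h : TripleProductProperty S T U)
    (hS₀ : (univ.filter fun a : A => ρ a ∈ S).card = 1) (hS₁ : (univ.filter fun a : A => τ a ∈ S).card = 1)
    (hT : (univ.filter fun a : A => ρ a ∈ T).card = (univ.filter fun a : A => τ a ∈ T).card)
    (hU : (univ.filter fun a : A => ρ a ∈ U).card = (univ.filter fun a : A => τ a ∈ U).card)
    (hV : 3 * (S.card * T.card * U.card) + 8 = 8 * Fintype.card A) :
    Fintype.card B ∣ (3 * (univ.filter fun a : A => ρ a ∈ T).card ^ 2) ^ (p - 1) - 1 ∧
      Fintype.card B ∣ (3 * (univ.filter fun a : A => ρ a ∈ U).card ^ 2) ^ (p - 1) - 1 := by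
  obtain ⟨X, Y, β, γ, x₀, hX, hY, hinj, hPQ, hPR, hQR, hcover⟩ :=
    domino_shifted_form_of_law hρρ hρτ hτρ hττ hρ hτ hne hsurj h hS₀ hS₁ hT hU hV
  set F : B → ℕ := fun u => (X.filter fun a => φ a = u).card with hFdef
  set Gc : B → ℕ := fun u => (Y.filter fun a => φ a = u).card with hGdef
  have hID : ∀ t : B, (∑ u, (F (t - u) + F (u - (t - φ β)) + F ((t - φ γ) + u)) * Gc u) +
      (if φ x₀ = t then 1 else 0) = (univ.filter fun a : A => φ a = 0).card := by
    intro t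
    rw [← card_fibre_eq_of_surjective φ hφ t 0]
    exact radon_identity_shifted φ hinj hPQ hPR hQR hcover t
  have hFX : ∑ v, F v = X.card :=
    (card_eq_sum_card_fiberwise (f := φ) (s := X) (t := univ) fun x _ => Finset.mem_coe.2 (mem_univ _)).symm
  have hGY : ∑ v, Gc v = Y.card :=
    (card_eq_sum_card_fiberwise (f := φ) (s := Y) (t := univ) fun x _ => Finset.mem_coe.2 (mem_univ _)).symm
  constructor
  · have h1 := DominoNorm.card_dvd_of_shifted_line_identity hp5 hexp F Gc (φ β) (φ γ) (φ x₀) _ hID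
    rwa [hFX, hX] at h1
  · have h2 := DominoNorm.card_dvd_of_shifted_line_identity' hp5 hexp F Gc (φ β) (φ γ) (φ x₀) _ hID
    rwa [hGY, hY] at h2

omit [AddCommGroup A] [DecidableEq A] [Group G] in
/-- Mass relation of a domino cube law triple: `3de + 1 = |A|`. [folklore] -/
theorem domino_law_mass (hρ : Function.Injective ρ) (hτ : Function.Injective τ) (hne : ∀ a b, ρ a ≠ τ b)
    (hsurj : ∀ g, (∃ a, ρ a = g) ∨ (∃ a, τ a = g)) {d e : ℕ}
    (hS₀ : (univ.filter fun a : A => ρ a ∈ S).card = 1) (hS₁ : (univ.filter fun a : A => τ a ∈ S).card = 1)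
    (hT₀ : (univ.filter fun a : A => ρ a ∈ T).card = d) (hT₁ : (univ.filter fun a : A => τ a ∈ T).card = d)
    (hU₀ : (univ.filter fun a : A => ρ a ∈ U).card = e) (hU₁ : (univ.filter fun a : A => τ a ∈ U).card = e)
    (hV : 3 * (S.card * T.card * U.card) + 8 = 8 * Fintype.card A) : 3 * d * e + 1 = Fintype.card A := by
  have cS := card_eq_parts' hρ hτ hne hsurj S
  have cT := card_eq_parts' hρ hτ hne hsurj T
  have cU := card_eq_parts' hρ hτ hne hsurj U
  rw [hS₀, hS₁] at cS
  rw [hT₀, hT₁] at cT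
  rw [hU₀, hU₁] at cU
  rw [cS, cT, cU] at hV
  have : 3 * ((1 + 1) * (d + d) * (e + e)) = 8 * (3 * d * e) := by ring
  omega

end DihedralLike

/-! ## `B = ℤ_p × ℤ_p` -/

section ZpZp

variable {p : ℕ} [hp : Fact p.Prime]

/-- `ℤ_p × ℤ_p` has exponent `p`. [folklore] -/
theorem zmodSq_nsmul_eq_zero (b : ZMod p × ZMod p) : p • b = 0 := by
  ext <;> simp

/-- `|ℤ_p × ℤ_p| = p²`. [folklore] -/
theorem card_zmodSq : Fintype.card (ZMod p × ZMod p) = p ^ 2 := by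
  rw [Fintype.card_prod, ZMod.card, sq]

variable {A : Type*} [AddCommGroup A] [DecidableEq A] [Fintype A] {G : Type} [Group G] [DecidableEq G]
  {ρ τ : A → G} {c₀ : A} {S T U : Finset G}

/-- **`ℤ_p × ℤ_p` quotients**: a domino cube law triple with `T`-parts of size `d` and `U`-parts of size `e` over
`A ↠ ℤ_p × ℤ_p` (`p ≥ 5`) needs `p² ∣ (3d²)^{p−1} − 1` and `p² ∣ (3e²)^{p−1} − 1`. [folklore] -/
theorem sq_dvd_of_domino_law_onto_zpzp
    (hρρ : ∀ a b, ρ a * ρ b = ρ (a + b)) (hρτ : ∀ a b, ρ a * τ b = τ (b - a))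
    (hτρ : ∀ a b, τ a * ρ b = τ (a + b)) (hττ : ∀ a b, τ a * τ b = ρ (c₀ + b - a))
    (hρ : Function.Injective ρ) (hτ : Function.Injective τ) (hne : ∀ a b, ρ a ≠ τ b)
    (hsurj : ∀ g, (∃ a, ρ a = g) ∨ (∃ a, τ a = g))
    (φ : A →+ ZMod p × ZMod p) (hφ : Function.Surjective φ) (hp5 : 5 ≤ p)
    (h : TripleProductProperty S T U) {d e : ℕ}
    (hS₀ : (univ.filter fun a : A => ρ a ∈ S).card = 1) (hS₁ : (univ.filter fun a : A => τ a ∈ S).card = 1)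
    (hT₀ : (univ.filter fun a : A => ρ a ∈ T).card = d) (hT₁ : (univ.filter fun a : A => τ a ∈ T).card = d)
    (hU₀ : (univ.filter fun a : A => ρ a ∈ U).card = e) (hU₁ : (univ.filter fun a : A => τ a ∈ U).card = e)
    (hV : 3 * (S.card * T.card * U.card) + 8 = 8 * Fintype.card A) :
    p ^ 2 ∣ (3 * d ^ 2) ^ (p - 1) - 1 ∧ p ^ 2 ∣ (3 * e ^ 2) ^ (p - 1) - 1 := by
  have h := card_dvd_of_domino_law_onto hρρ hρτ hτρ hττ hρ hτ hne hsurj φ hφ hp5 zmodSq_nsmul_eq_zero h hS₀ hS₁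
    (hT₀.trans hT₁.symm) (hU₀.trans hU₁.symm) hV
  rwa [card_zmodSq, hT₀, hU₀] at h


/-- **Cell closer, `T`-side**: over any `A ↠ ℤ_p × ℤ_p` (`p ≥ 5`), a domino cube law triple whose `T`-parts have a size `d`
with `p² ∤ (3d²)^{p−1} − 1` does not exist (instantiate `hnd` by `decide`). [folklore] -/
theorem no_law_cube_1d_of_onto_zpzp
    (hρρ : ∀ a b, ρ a * ρ b = ρ (a + b)) (hρτ : ∀ a b, ρ a * τ b = τ (b - a))
    (hτρ : ∀ a b, τ a * ρ b = τ (a + b)) (hττ : ∀ a b, τ a * τ b = ρ (c₀ + b - a))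
    (hρ : Function.Injective ρ) (hτ : Function.Injective τ) (hne : ∀ a b, ρ a ≠ τ b)
    (hsurj : ∀ g, (∃ a, ρ a = g) ∨ (∃ a, τ a = g))
    (φ : A →+ ZMod p × ZMod p) (hφ : Function.Surjective φ) (hp5 : 5 ≤ p) {d : ℕ}
    (hnd : ¬ p ^ 2 ∣ (3 * d ^ 2) ^ (p - 1) - 1)
    (h : TripleProductProperty S T U)
    (hS₀ : (univ.filter fun a : A => ρ a ∈ S).card = 1) (hS₁ : (univ.filter fun a : A => τ a ∈ S).card = 1)
    (hT₀ : (univ.filter fun a : A => ρ a ∈ T).card = d) (hT₁ : (univ.filter fun a : A => τ a ∈ T).card = d)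
    (hU : (univ.filter fun a : A => ρ a ∈ U).card = (univ.filter fun a : A => τ a ∈ U).card)
    (hV : 3 * (S.card * T.card * U.card) + 8 = 8 * Fintype.card A) : False :=
  hnd (sq_dvd_of_domino_law_onto_zpzp hρρ hρτ hτρ hττ hρ hτ hne hsurj φ hφ hp5 h hS₀ hS₁ hT₀ hT₁ rfl hU.symm hV).1

/-- **Cell closer, `U`-side**: the same with the `U`-parts of size `e`, `p² ∤ (3e²)^{p−1} − 1`. [folklore] -/
theorem no_law_cube_1_e_of_onto_zpzp
    (hρρ : ∀ a b, ρ a * ρ b = ρ (a + b)) (hρτ : ∀ a b, ρ a * τ b = τ (b - a))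
    (hτρ : ∀ a b, τ a * ρ b = τ (a + b)) (hττ : ∀ a b, τ a * τ b = ρ (c₀ + b - a))
    (hρ : Function.Injective ρ) (hτ : Function.Injective τ) (hne : ∀ a b, ρ a ≠ τ b)
    (hsurj : ∀ g, (∃ a, ρ a = g) ∨ (∃ a, τ a = g))
    (φ : A →+ ZMod p × ZMod p) (hφ : Function.Surjective φ) (hp5 : 5 ≤ p) {e : ℕ}
    (hne' : ¬ p ^ 2 ∣ (3 * e ^ 2) ^ (p - 1) - 1)
    (h : TripleProductProperty S T U)
    (hS₀ : (univ.filter fun a : A => ρ a ∈ S).card = 1) (hS₁ : (univ.filter fun a : A => τ a ∈ S).card = 1)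
    (hT : (univ.filter fun a : A => ρ a ∈ T).card = (univ.filter fun a : A => τ a ∈ T).card)
    (hU₀ : (univ.filter fun a : A => ρ a ∈ U).card = e) (hU₁ : (univ.filter fun a : A => τ a ∈ U).card = e)
    (hV : 3 * (S.card * T.card * U.card) + 8 = 8 * Fintype.card A) : False :=
  hne' (sq_dvd_of_domino_law_onto_zpzp hρρ hρτ hτρ hττ hρ hτ hne hsurj φ hφ hp5 h hS₀ hS₁ rfl hT.symm hU₀ hU₁ hV).2

/-- Example (census cell `(1,14,20)@841`, NR212, formerly ENGINE ×1): no `(1,1 | 14,14 | e,e)` law triple over any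
`A ↠ ℤ₂₉ × ℤ₂₉`. [folklore] -/
theorem no_law_cube_1_14_e_of_onto_z29z29
    (hρρ : ∀ a b, ρ a * ρ b = ρ (a + b)) (hρτ : ∀ a b, ρ a * τ b = τ (b - a))
    (hτρ : ∀ a b, τ a * ρ b = τ (a + b)) (hττ : ∀ a b, τ a * τ b = ρ (c₀ + b - a))
    (hρ : Function.Injective ρ) (hτ : Function.Injective τ) (hne : ∀ a b, ρ a ≠ τ b)
    (hsurj : ∀ g, (∃ a, ρ a = g) ∨ (∃ a, τ a = g))
    (φ : A →+ ZMod 29 × ZMod 29) (hφ : Function.Surjective φ)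
    (h : TripleProductProperty S T U)
    (hS₀ : (univ.filter fun a : A => ρ a ∈ S).card = 1) (hS₁ : (univ.filter fun a : A => τ a ∈ S).card = 1)
    (hT₀ : (univ.filter fun a : A => ρ a ∈ T).card = 14) (hT₁ : (univ.filter fun a : A => τ a ∈ T).card = 14)
    (hU : (univ.filter fun a : A => ρ a ∈ U).card = (univ.filter fun a : A => τ a ∈ U).card)
    (hV : 3 * (S.card * T.card * U.card) + 8 = 8 * Fintype.card A) : False :=
  haveI : Fact (Nat.Prime 29) := ⟨by decide⟩
  no_law_cube_1d_of_onto_zpzp hρρ hρτ hτρ hττ hρ hτ hne hsurj φ hφ (by norm_num) (by decide) h hS₀ hS₁ hT₀ hT₁ hU hV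

/-- Example (census cell `(1,16,20)@961`, NR212, formerly ENGINE ×1): no `(1,1 | 16,16 | e,e)` law triple over any
`A ↠ ℤ₃₁ × ℤ₃₁`. [folklore] -/
theorem no_law_cube_1_16_e_of_onto_z31z31
    (hρρ : ∀ a b, ρ a * ρ b = ρ (a + b)) (hρτ : ∀ a b, ρ a * τ b = τ (b - a))
    (hτρ : ∀ a b, τ a * ρ b = τ (a + b)) (hττ : ∀ a b, τ a * τ b = ρ (c₀ + b - a))
    (hρ : Function.Injective ρ) (hτ : Function.Injective τ) (hne : ∀ a b, ρ a ≠ τ b)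
    (hsurj : ∀ g, (∃ a, ρ a = g) ∨ (∃ a, τ a = g))
    (φ : A →+ ZMod 31 × ZMod 31) (hφ : Function.Surjective φ)
    (h : TripleProductProperty S T U)
    (hS₀ : (univ.filter fun a : A => ρ a ∈ S).card = 1) (hS₁ : (univ.filter fun a : A => τ a ∈ S).card = 1)
    (hT₀ : (univ.filter fun a : A => ρ a ∈ T).card = 16) (hT₁ : (univ.filter fun a : A => τ a ∈ T).card = 16)
    (hU : (univ.filter fun a : A => ρ a ∈ U).card = (univ.filter fun a : A => τ a ∈ U).card)
    (hV : 3 * (S.card * T.card * U.card) + 8 = 8 * Fintype.card A) : False :=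
  haveI : Fact (Nat.Prime 31) := ⟨by decide⟩
  no_law_cube_1d_of_onto_zpzp hρρ hρτ hτρ hττ hρ hτ hne hsurj φ hφ (by norm_num) (by decide) h hS₀ hS₁ hT₀ hT₁ hU hV

/-- **The `ℤ_p × ℤ_p` domino column at order `p²`, all `d` at once.**  If `|A| = p²` then `d e = (p² − 1)/3`, so a domino
cube law triple needs a divisor `d` of `(p²−1)/3` with BOTH `p² ∣ (3d²)^{p−1} − 1` and `p² ∣ (3(N/d)²)^{p−1} − 1`; this
packages the finite check. [folklore] -/
theorem no_domino_law_onto_zpzp_of_forall_divisors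
    (hρρ : ∀ a b, ρ a * ρ b = ρ (a + b)) (hρτ : ∀ a b, ρ a * τ b = τ (b - a))
    (hτρ : ∀ a b, τ a * ρ b = τ (a + b)) (hττ : ∀ a b, τ a * τ b = ρ (c₀ + b - a))
    (hρ : Function.Injective ρ) (hτ : Function.Injective τ) (hne : ∀ a b, ρ a ≠ τ b)
    (hsurj : ∀ g, (∃ a, ρ a = g) ∨ (∃ a, τ a = g))
    (φ : A →+ ZMod p × ZMod p) (hφ : Function.Surjective φ) (hp5 : 5 ≤ p) {N : ℕ} (hN : 3 * N + 1 = p ^ 2)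
    (hcheck : ∀ d ∈ Nat.divisors N, ¬ (p ^ 2 ∣ (3 * d ^ 2) ^ (p - 1) - 1 ∧ p ^ 2 ∣ (3 * (N / d) ^ 2) ^ (p - 1) - 1))
    (hA : Fintype.card A = p ^ 2)
    (h : TripleProductProperty S T U)
    (hS₀ : (univ.filter fun a : A => ρ a ∈ S).card = 1) (hS₁ : (univ.filter fun a : A => τ a ∈ S).card = 1)
    (hT : (univ.filter fun a : A => ρ a ∈ T).card = (univ.filter fun a : A => τ a ∈ T).card)
    (hU : (univ.filter fun a : A => ρ a ∈ U).card = (univ.filter fun a : A => τ a ∈ U).card)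
    (hV : 3 * (S.card * T.card * U.card) + 8 = 8 * Fintype.card A) : False := by
  set d := (univ.filter fun a : A => ρ a ∈ T).card with hd
  set e := (univ.filter fun a : A => ρ a ∈ U).card with he
  have hmass := domino_law_mass hρ hτ hne hsurj hS₀ hS₁ rfl hT.symm rfl hU.symm hV
  rw [hA, ← hN] at hmass
  have hde : d * e = N := by
    have h3 : 3 * (d * e) + 1 = 3 * N + 1 := by rw [← mul_assoc]; exact hmass
    omega
  have hN0 : N ≠ 0 := by
    intro h0; rw [h0] at hN; have : 5 ^ 2 ≤ p ^ 2 := Nat.pow_le_pow_left hp5 2; omega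
  have hdN : d ∈ Nat.divisors N := Nat.mem_divisors.2 ⟨Dvd.intro e hde, hN0⟩
  have hd0 : d ≠ 0 := fun h0 => hN0 (by rw [← hde, h0, zero_mul])
  have heq : N / d = e := by rw [← hde, Nat.mul_div_cancel_left e (Nat.pos_of_ne_zero hd0)]
  have hsq := sq_dvd_of_domino_law_onto_zpzp hρρ hρτ hτρ hττ hρ hτ hne hsurj φ hφ hp5 h hS₀ hS₁ rfl hT.symm rfl hU.symm hV
  exact hcheck d hdN (heq ▸ hsq)

/-- **No domino cube law triple over `A ↠ ℤ_p × ℤ_p`, `|A| = p²`, for `p = 5, 17, 19, 23, 29, 31`** (every `d`): no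
divisor `d` of `(p²−1)/3` has both `(3d²)^{p−1} ≡ 1` and `(3(N/d)²)^{p−1} ≡ 1 (mod p²)`.  In particular the census cells
`(1,d,e)@289, @361, @529, @841, @961` are all kernel NONE. [folklore] -/
theorem no_domino_law_onto_zpzp_sq
    (hρρ : ∀ a b, ρ a * ρ b = ρ (a + b)) (hρτ : ∀ a b, ρ a * τ b = τ (b - a))
    (hτρ : ∀ a b, τ a * ρ b = τ (a + b)) (hττ : ∀ a b, τ a * τ b = ρ (c₀ + b - a))
    (hρ : Function.Injective ρ) (hτ : Function.Injective τ) (hne : ∀ a b, ρ a ≠ τ b)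
    (hsurj : ∀ g, (∃ a, ρ a = g) ∨ (∃ a, τ a = g))
    (hp : p = 5 ∨ p = 17 ∨ p = 19 ∨ p = 23 ∨ p = 29 ∨ p = 31)
    (φ : A →+ ZMod p × ZMod p) (hφ : Function.Surjective φ) (hA : Fintype.card A = p ^ 2)
    (h : TripleProductProperty S T U)
    (hS₀ : (univ.filter fun a : A => ρ a ∈ S).card = 1) (hS₁ : (univ.filter fun a : A => τ a ∈ S).card = 1)
    (hT : (univ.filter fun a : A => ρ a ∈ T).card = (univ.filter fun a : A => τ a ∈ T).card)
    (hU : (univ.filter fun a : A => ρ a ∈ U).card = (univ.filter fun a : A => τ a ∈ U).card)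
    (hV : 3 * (S.card * T.card * U.card) + 8 = 8 * Fintype.card A) : False := by
  rcases hp with rfl | rfl | rfl | rfl | rfl | rfl
  · exact no_domino_law_onto_zpzp_of_forall_divisors hρρ hρτ hτρ hττ hρ hτ hne hsurj φ hφ (by norm_num) (N := 8)
      (by norm_num) (by decide) hA h hS₀ hS₁ hT hU hV
  · exact no_domino_law_onto_zpzp_of_forall_divisors hρρ hρτ hτρ hττ hρ hτ hne hsurj φ hφ (by norm_num) (N := 96)
      (by norm_num) (by decide) hA h hS₀ hS₁ hT hU hV
  · exact no_domino_law_onto_zpzp_of_forall_divisors hρρ hρτ hτρ hττ hρ hτ hne hsurj φ hφ (by norm_num) (N := 120)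
      (by norm_num) (by decide) hA h hS₀ hS₁ hT hU hV
  · exact no_domino_law_onto_zpzp_of_forall_divisors hρρ hρτ hτρ hττ hρ hτ hne hsurj φ hφ (by norm_num) (N := 176)
      (by norm_num) (by decide) hA h hS₀ hS₁ hT hU hV
  · exact no_domino_law_onto_zpzp_of_forall_divisors hρρ hρτ hτρ hττ hρ hτ hne hsurj φ hφ (by norm_num) (N := 280)
      (by norm_num) (by decide) hA h hS₀ hS₁ hT hU hV
  · exact no_domino_law_onto_zpzp_of_forall_divisors hρρ hρτ hτρ hττ hρ hτ hne hsurj φ hφ (by norm_num) (N := 320)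
      (by norm_num) (by decide) hA h hS₀ hS₁ hT hU hV

/-- **`p = 7, 11, 13`: the only surviving domino shapes.**  Over `A ↠ ℤ_p²` with `|A| = p²`, a domino cube law triple has
`T`-part size `d = 4` (`p = 7`), `d ∈ {1, 40}` (`p = 11`), `d ∈ {7, 8}` (`p = 13`). [folklore] -/
theorem domino_law_onto_zpzp_sq_survivors
    (hρρ : ∀ a b, ρ a * ρ b = ρ (a + b)) (hρτ : ∀ a b, ρ a * τ b = τ (b - a))
    (hτρ : ∀ a b, τ a * ρ b = τ (a + b)) (hττ : ∀ a b, τ a * τ b = ρ (c₀ + b - a))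
    (hρ : Function.Injective ρ) (hτ : Function.Injective τ) (hne : ∀ a b, ρ a ≠ τ b)
    (hsurj : ∀ g, (∃ a, ρ a = g) ∨ (∃ a, τ a = g))
    (hp : p = 7 ∨ p = 11 ∨ p = 13)
    (φ : A →+ ZMod p × ZMod p) (hφ : Function.Surjective φ) (hA : Fintype.card A = p ^ 2)
    (h : TripleProductProperty S T U)
    (hS₀ : (univ.filter fun a : A => ρ a ∈ S).card = 1) (hS₁ : (univ.filter fun a : A => τ a ∈ S).card = 1)
    (hT : (univ.filter fun a : A => ρ a ∈ T).card = (univ.filter fun a : A => τ a ∈ T).card)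
    (hU : (univ.filter fun a : A => ρ a ∈ U).card = (univ.filter fun a : A => τ a ∈ U).card)
    (hV : 3 * (S.card * T.card * U.card) + 8 = 8 * Fintype.card A) :
    (p = 7 ∧ (univ.filter fun a : A => ρ a ∈ T).card = 4) ∨
      (p = 11 ∧ ((univ.filter fun a : A => ρ a ∈ T).card = 1 ∨ (univ.filter fun a : A => ρ a ∈ T).card = 40)) ∨
      (p = 13 ∧ ((univ.filter fun a : A => ρ a ∈ T).card = 7 ∨ (univ.filter fun a : A => ρ a ∈ T).card = 8)) := by
  set d := (univ.filter fun a : A => ρ a ∈ T).card with hd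
  set e := (univ.filter fun a : A => ρ a ∈ U).card with he
  have hmass := domino_law_mass hρ hτ hne hsurj hS₀ hS₁ rfl hT.symm rfl hU.symm hV
  rw [hA] at hmass
  rcases hp with rfl | rfl | rfl
  · have hsq := sq_dvd_of_domino_law_onto_zpzp hρρ hρτ hτρ hττ hρ hτ hne hsurj φ hφ (by norm_num) h hS₀ hS₁ rfl hT.symm
      rfl hU.symm hV
    have hde : d * e = 16 := by
      have h3 : 3 * (d * e) + 1 = 49 := by rw [← mul_assoc]; norm_num at hmass; exact hmass
      omega
    have hdN : d ∈ Nat.divisors 16 := Nat.mem_divisors.2 ⟨Dvd.intro e hde, by norm_num⟩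
    exact Or.inl ⟨rfl, (by decide : ∀ d ∈ Nat.divisors 16, 7 ^ 2 ∣ (3 * d ^ 2) ^ (7 - 1) - 1 → d = 4) d hdN hsq.1⟩
  · have hsq := sq_dvd_of_domino_law_onto_zpzp hρρ hρτ hτρ hττ hρ hτ hne hsurj φ hφ (by norm_num) h hS₀ hS₁ rfl hT.symm
      rfl hU.symm hV
    have hde : d * e = 40 := by
      have h3 : 3 * (d * e) + 1 = 121 := by rw [← mul_assoc]; norm_num at hmass; exact hmass
      omega
    have hdN : d ∈ Nat.divisors 40 := Nat.mem_divisors.2 ⟨Dvd.intro e hde, by norm_num⟩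
    exact Or.inr (Or.inl ⟨rfl,
      (by decide : ∀ d ∈ Nat.divisors 40, 11 ^ 2 ∣ (3 * d ^ 2) ^ (11 - 1) - 1 → d = 1 ∨ d = 40) d hdN hsq.1⟩)
  · have hsq := sq_dvd_of_domino_law_onto_zpzp hρρ hρτ hτρ hττ hρ hτ hne hsurj φ hφ (by norm_num) h hS₀ hS₁ rfl hT.symm
      rfl hU.symm hV
    have hde : d * e = 56 := by
      have h3 : 3 * (d * e) + 1 = 169 := by rw [← mul_assoc]; norm_num at hmass; exact hmass
      omega
    have hdN : d ∈ Nat.divisors 56 := Nat.mem_divisors.2 ⟨Dvd.intro e hde, by norm_num⟩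
    exact Or.inr (Or.inr ⟨rfl,
      (by decide : ∀ d ∈ Nat.divisors 56, 13 ^ 2 ∣ (3 * d ^ 2) ^ (13 - 1) - 1 → d = 7 ∨ d = 8) d hdN hsq.1⟩)

end ZpZp

/-! ## `B = (ℤ_p)^m` -/

section ZpPow

variable {p : ℕ} [hp : Fact p.Prime] {m : ℕ}

/-- `(ℤ_p)^m` has exponent `p`. [folklore] -/
theorem zmodFun_nsmul_eq_zero (b : Fin m → ZMod p) : p • b = 0 := by
  ext i; simp

/-- `|(ℤ_p)^m| = p^m`. [folklore] -/
theorem card_zmodFun : Fintype.card (Fin m → ZMod p) = p ^ m := by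
  rw [Fintype.card_fun, ZMod.card, Fintype.card_fin]

variable {A : Type*} [AddCommGroup A] [DecidableEq A] [Fintype A] {G : Type} [Group G] [DecidableEq G]
  {ρ τ : A → G} {c₀ : A} {S T U : Finset G}

/-- **`(ℤ_p)^m` quotients**: a domino cube law triple with part sizes `d`, `e` over `A ↠ (ℤ_p)^m` (`p ≥ 5`) needs
`p^m ∣ (3d²)^{p−1} − 1` and `p^m ∣ (3e²)^{p−1} − 1` — e.g. over `A ↠ ℤ₅³` (orders `625 = |ℤ₅⁴|, |ℤ₅²×ℤ₂₅|`, …) the cell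
`(1,13,16)` is excluded since `125 ∤ 507⁴ − 1` (`no_law_cube_1_13_16_of_onto_z5_cube`). [folklore] -/
theorem pow_dvd_of_domino_law_onto_zmodFun
    (hρρ : ∀ a b, ρ a * ρ b = ρ (a + b)) (hρτ : ∀ a b, ρ a * τ b = τ (b - a))
    (hτρ : ∀ a b, τ a * ρ b = τ (a + b)) (hττ : ∀ a b, τ a * τ b = ρ (c₀ + b - a))
    (hρ : Function.Injective ρ) (hτ : Function.Injective τ) (hne : ∀ a b, ρ a ≠ τ b)
    (hsurj : ∀ g, (∃ a, ρ a = g) ∨ (∃ a, τ a = g))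
    (φ : A →+ (Fin m → ZMod p)) (hφ : Function.Surjective φ) (hp5 : 5 ≤ p)
    (h : TripleProductProperty S T U) {d e : ℕ}
    (hS₀ : (univ.filter fun a : A => ρ a ∈ S).card = 1) (hS₁ : (univ.filter fun a : A => τ a ∈ S).card = 1)
    (hT₀ : (univ.filter fun a : A => ρ a ∈ T).card = d) (hT₁ : (univ.filter fun a : A => τ a ∈ T).card = d)
    (hU₀ : (univ.filter fun a : A => ρ a ∈ U).card = e) (hU₁ : (univ.filter fun a : A => τ a ∈ U).card = e)
    (hV : 3 * (S.card * T.card * U.card) + 8 = 8 * Fintype.card A) :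
    p ^ m ∣ (3 * d ^ 2) ^ (p - 1) - 1 ∧ p ^ m ∣ (3 * e ^ 2) ^ (p - 1) - 1 := by
  have h := card_dvd_of_domino_law_onto hρρ hρτ hτρ hττ hρ hτ hne hsurj φ hφ hp5 zmodFun_nsmul_eq_zero h hS₀ hS₁
    (hT₀.trans hT₁.symm) (hU₀.trans hU₁.symm) hV
  rwa [card_zmodFun, hT₀, hU₀] at h

/-- Census cell `(1,13,16)` over any `A ↠ ℤ₅ × ℤ₅ × ℤ₅` (e.g. `ℤ₅⁴`, `ℤ₅² × ℤ₂₅` at order `625`): impossible, since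
`125 ∤ (3·13²)⁴ − 1`. [folklore] -/
theorem no_law_cube_1_13_16_of_onto_z5_cube
    (hρρ : ∀ a b, ρ a * ρ b = ρ (a + b)) (hρτ : ∀ a b, ρ a * τ b = τ (b - a))
    (hτρ : ∀ a b, τ a * ρ b = τ (a + b)) (hττ : ∀ a b, τ a * τ b = ρ (c₀ + b - a))
    (hρ : Function.Injective ρ) (hτ : Function.Injective τ) (hne : ∀ a b, ρ a ≠ τ b)
    (hsurj : ∀ g, (∃ a, ρ a = g) ∨ (∃ a, τ a = g))
    (φ : A →+ (Fin 3 → ZMod 5)) (hφ : Function.Surjective φ)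
    (h : TripleProductProperty S T U)
    (hS₀ : (univ.filter fun a : A => ρ a ∈ S).card = 1) (hS₁ : (univ.filter fun a : A => τ a ∈ S).card = 1)
    (hT₀ : (univ.filter fun a : A => ρ a ∈ T).card = 13) (hT₁ : (univ.filter fun a : A => τ a ∈ T).card = 13)
    (hU : (univ.filter fun a : A => ρ a ∈ U).card = (univ.filter fun a : A => τ a ∈ U).card)
    (hV : 3 * (S.card * T.card * U.card) + 8 = 8 * Fintype.card A) : False := by
  haveI : Fact (Nat.Prime 5) := ⟨by decide⟩
  have h := (pow_dvd_of_domino_law_onto_zmodFun hρρ hρτ hτρ hττ hρ hτ hne hsurj φ hφ (le_refl 5) h hS₀ hS₁ hT₀ hT₁ rfl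
    hU.symm hV).1
  revert h
  decide

end ZpPow

end Summit.MatrixMultiplication.OmegaCensus
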